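import Mathlib
import HarnessLib
import Summits.ValiantsHypothesis.ValiantsHypothesis.Theorems.LacunarySymmetroidMatrixDescartesProductPlusOneRealRootedWindows

/-!
# LINE (A) `product_plus_one` (crux `MatrixDescartes`, stmt-ValiantsHypothesis-18050, V1) — W-CB, the SLOW-KNEE CLOUD CELL, part (E1):
# the KERNEL-PLUS-CONVEX inner shell `F = Σ_i w_iρ_i/(y − ρ_i)² + G(y)` has NO THREE ZEROS on the window

Owner memo `pub/ideators/val-idea-25/NOTE-idea25g3-18050-LINEA-AB-reduction.md` §19.1 (E1) (val-idea-25 g4; typed scratch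
`staged/scratch19-slowknee-cloud-cell.lean`, decl `KernelPlusConvexInnerShell`): ✓ `rootKernel_inner_no_three_zeros` (`…RealRootedWindows`) with the
RIGHT roots replaced by an added function `G` that is non-decreasing and convex on the window `(a,b)`; every root `ρ_i ≤ a`, one of them positive,
weights `w_i > 0`.  Proof: with the shift `σ ≥ 0` of ✓ `exists_sigma`, the left kernel `K = Σ w_iρ_i/(y−ρ_i)²` has `K″ + σK′ > 0` on `y > a`
(the STRICT second-order rearrangement `key2_term_strict` / `key2_sum_strict` below — strictness from the positive root, the pattern of
✓ `key1_term_strict`), so `e^{σy}K′` is strictly increasing; `e^{σy}G′` is non-decreasing (`σ ≥ 0`, `G′ ≥ 0` non-decreasing); hence `e^{σy}F′` is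
strictly increasing and ✓ `no_three_zeros_of_strictMonoOn_exp_mul_deriv` (Rolle twice) forbids three zeros of `F`.

* §1 `key2_term_strict`, `key2_sum_strict`, `leftKernel_convexity_pos` (`K″ + σK′ > 0` to the right of all roots);
* §2 ★ `kernelPlusConvex_inner_no_three_zeros` — MONOTONE FORM (hypotheses: `HasDerivAt G (G′ y) y`, `0 ≤ G′`, `G′` monotone on `(a,b)`; no `G″`);
  ★ `kernelPlusConvexInnerShell` — the owner's typed form VERBATIM (`G′`, `G″` with `HasDerivAt G′ (G″ y) y`, `0 ≤ G′`, `0 ≤ G″`), as a corollary.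

Used by (E4) `SlowKneeCloudCellK3` (next file): after `y = x^p` the slow knees and switched pullers are the left kernel, the unswitched cloud is `G`
(convex non-decreasing by (E2) `CloudConvexity`).  Honest framing: calculus on root sums; a lemma of ONE W-cell; NOT `WronskianBudgetK3` /
`OneChangeFloorK3` / `stub_classRowK3` / `stub_polyLaw` / `MatrixDescartes` / B; `VP ≠ VNP` NOT proved.  No definitions, no named facts; Mathlib +
✓ `…RealRootedKernel` / `…RealRootedWindows` only.
-/

set_option linter.dupNamespace false

namespace Summit.ValiantsHypothesis.ValiantsHypothesis.Theorems.LacunarySymmetroidMatrixDescartes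

namespace ProductPlusOne

open Finset Set
open scoped BigOperators Topology

/-! ### §1 The strict second-order rearrangement and `K″ + σK′ > 0` -/

/-- The second-order termwise inequality of ✓ `key2_term` is STRICT for `w > 0`, `ρ ≠ 0`:
`((6 − 2σx)/x⁴)·(wρe^{ρσ}) < w·ρ(6 − 2σ(x−ρ))/(x−ρ)⁴`. [this file's lemma] -/
theorem key2_term_strict (x σ w ρ : ℝ) (hx : 0 < x) (hρ : ρ < x) (hw : 0 < w) (hρ0 : ρ ≠ 0) :
    (6 - 2 * σ * x) / x ^ 4 * (w * ρ * Real.exp (σ * ρ)) < w * ρ * (6 - 2 * σ * (x - ρ)) / (x - ρ) ^ 4 := by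
  have hmono := strictMonoOn_chi2 x σ
  have h0 : (0 : ℝ) ∈ Iio x := hx
  have hρ' : ρ ∈ Iio x := hρ
  have hχ0 : Real.exp (-(σ * 0)) * (6 - 2 * σ * (x - 0)) / (x - 0) ^ 4 = (6 - 2 * σ * x) / x ^ 4 := by simp
  have hχρ : w * ρ * Real.exp (σ * ρ) * (Real.exp (-(σ * ρ)) * (6 - 2 * σ * (x - ρ)) / (x - ρ) ^ 4)
      = w * ρ * (6 - 2 * σ * (x - ρ)) / (x - ρ) ^ 4 := by
    rw [mul_div_assoc, ← mul_assoc, mul_assoc (w * ρ), ← Real.exp_add, add_neg_cancel, Real.exp_zero, mul_one,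
      mul_div_assoc]
  rw [← hχρ, ← hχ0, mul_comm ((Real.exp (-(σ * 0)) * (6 - 2 * σ * (x - 0)) / (x - 0) ^ 4)) (w * ρ * Real.exp (σ * ρ))]
  rcases lt_or_gt_of_ne hρ0 with hρn | hρp
  · have hlt : Real.exp (-(σ * ρ)) * (6 - 2 * σ * (x - ρ)) / (x - ρ) ^ 4
        < Real.exp (-(σ * 0)) * (6 - 2 * σ * (x - 0)) / (x - 0) ^ 4 := hmono hρ' h0 hρn
    have hneg : w * ρ * Real.exp (σ * ρ) < 0 :=
      mul_neg_of_neg_of_pos (mul_neg_of_pos_of_neg hw hρn) (Real.exp_pos _)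
    exact mul_lt_mul_of_neg_left hlt hneg
  · have hlt : Real.exp (-(σ * 0)) * (6 - 2 * σ * (x - 0)) / (x - 0) ^ 4
        < Real.exp (-(σ * ρ)) * (6 - 2 * σ * (x - ρ)) / (x - ρ) ^ 4 := hmono h0 hρ' hρp
    exact mul_lt_mul_of_pos_left hlt (mul_pos (mul_pos hw hρp) (Real.exp_pos _))

/-- **Second-order rearrangement, summed, STRICT** when some `ρ_i ≠ 0` (weights `w_i > 0`, roots `ρ_i < x`, `0 < x`):
`((6 − 2σx)/x⁴)·Σ w_iρ_ie^{ρ_iσ} < Σ w_iρ_i(6 − 2σ(x−ρ_i))/(x−ρ_i)⁴`. [this file's lemma] -/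
theorem key2_sum_strict {ι : Type*} (L : Finset ι) (w ρ : ι → ℝ) (x σ : ℝ) (hx : 0 < x)
    (hρ : ∀ i ∈ L, ρ i < x) (hw : ∀ i ∈ L, 0 < w i) (hne : ∃ i ∈ L, ρ i ≠ 0) :
    (6 - 2 * σ * x) / x ^ 4 * ∑ i ∈ L, w i * ρ i * Real.exp (σ * ρ i)
      < ∑ i ∈ L, w i * ρ i * (6 - 2 * σ * (x - ρ i)) / (x - ρ i) ^ 4 := by
  obtain ⟨k, hk, hk0⟩ := hne
  rw [Finset.mul_sum]
  exact Finset.sum_lt_sum (fun i hi => key2_term x σ (w i) (ρ i) hx (hρ i hi) (hw i hi).le)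
    ⟨k, hk, key2_term_strict x σ (w k) (ρ k) hx (hρ k hk) (hw k hk) hk0⟩

/-- **`K″ + σK′ > 0` to the right of all roots**: weights `w_i > 0`, every `ρ_i < x`, `0 < x`, some `ρ_i ≠ 0`, and `σ` a shift with
`Σ w_iρ_ie^{σρ_i} = 0` or (`σ = 0` and `Σ w_iρ_i ≥ 0`) (✓ `exists_sigma`); then
`Σ 6w_iρ_i/(x−ρ_i)⁴ + σ·Σ (−2w_iρ_i)/(x−ρ_i)³ > 0`. [this file's lemma] -/
theorem leftKernel_convexity_pos {ι : Type*} (L : Finset ι) (w ρ : ι → ℝ) (hw : ∀ i ∈ L, 0 < w i) {σ : ℝ}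
    (hσ : ∑ i ∈ L, w i * ρ i * Real.exp (σ * ρ i) = 0 ∨ (σ = 0 ∧ 0 ≤ ∑ i ∈ L, w i * ρ i))
    (hne : ∃ i ∈ L, ρ i ≠ 0) {x : ℝ} (hx : 0 < x) (hρ : ∀ i ∈ L, ρ i < x) :
    0 < ∑ i ∈ L, 6 * (w i * ρ i) / (x - ρ i) ^ 4 + σ * ∑ i ∈ L, -2 * (w i * ρ i) / (x - ρ i) ^ 3 := by
  have hcomb : ∑ i ∈ L, 6 * (w i * ρ i) / (x - ρ i) ^ 4 + σ * ∑ i ∈ L, -2 * (w i * ρ i) / (x - ρ i) ^ 3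
      = ∑ i ∈ L, w i * ρ i * (6 - 2 * σ * (x - ρ i)) / (x - ρ i) ^ 4 := by
    rw [Finset.mul_sum, ← Finset.sum_add_distrib]
    refine Finset.sum_congr rfl fun i hi => ?_
    have hc : x - ρ i ≠ 0 := sub_ne_zero.2 (ne_of_gt (hρ i hi))
    field_simp
    ring
  rw [hcomb]
  have h2 := key2_sum_strict L w ρ x σ hx hρ hw hne
  rcases hσ with hg | ⟨hσe, hg0⟩
  · rw [hg, mul_zero] at h2; exact h2
  · subst hσe
    have h6 : 0 ≤ (6 - 2 * (0 : ℝ) * x) / x ^ 4 := by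
      have : (6 - 2 * (0 : ℝ) * x) = 6 := by ring
      rw [this]; positivity
    have hg0' : 0 ≤ ∑ i ∈ L, w i * ρ i * Real.exp (0 * ρ i) := by simpa using hg0
    exact (mul_nonneg h6 hg0').trans_lt h2

/-! ### §2 The kernel-plus-convex inner shell -/

/-- ★ **KERNEL-PLUS-CONVEX INNER SHELL, monotone form**: weights `w_i > 0`, roots `ρ_i ≤ a` (`0 < a < b`), one of them positive; `G` differentiable
on `(a,b)` (any `b`) with `G′ ≥ 0` NON-DECREASING there.  Then `F(y) = Σ_i w_iρ_i/(y−ρ_i)² + G(y)` does not vanish at three points `y₁ < y₂ < y₃` of `(a,b)`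
(`e^{σy}F′` is strictly increasing for the shift `σ ≥ 0` of the roots). [this file's theorem] -/
theorem kernelPlusConvex_inner_no_three_zeros {ι : Type*} (s : Finset ι) (w ρ : ι → ℝ) (hw : ∀ i ∈ s, 0 < w i)
    {a b : ℝ} (ha : 0 < a) (hρ : ∀ i ∈ s, ρ i ≤ a) (hpos : ∃ i ∈ s, 0 < ρ i)
    {G G' : ℝ → ℝ} (hG : ∀ y ∈ Ioo a b, HasDerivAt G (G' y) y) (hG'0 : ∀ y ∈ Ioo a b, 0 ≤ G' y)
    (hG'mono : MonotoneOn G' (Ioo a b))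
    {y₁ y₂ y₃ : ℝ} (h₁ : y₁ ∈ Ioo a b) (h₃ : y₃ ∈ Ioo a b) (h12 : y₁ < y₂) (h23 : y₂ < y₃)
    (hz₁ : ∑ i ∈ s, w i * ρ i / (y₁ - ρ i) ^ 2 + G y₁ = 0) (hz₂ : ∑ i ∈ s, w i * ρ i / (y₂ - ρ i) ^ 2 + G y₂ = 0)
    (hz₃ : ∑ i ∈ s, w i * ρ i / (y₃ - ρ i) ^ 2 + G y₃ = 0) : False := by
  classical
  obtain ⟨σ, hσ0, hσ⟩ := exists_sigma s w ρ hw hpos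
  have hne0 : ∃ i ∈ s, ρ i ≠ 0 := by
    obtain ⟨i, hi, hρi⟩ := hpos
    exact ⟨i, hi, ne_of_gt hρi⟩
  -- no root in the window
  have hlt : ∀ y ∈ Ioo a b, ∀ i ∈ s, ρ i < y := fun y hy i hi => (hρ i hi).trans_lt hy.1
  have hne : ∀ y ∈ Ioo a b, ∀ i ∈ s, y ≠ ρ i := fun y hy i hi => (ne_of_lt (hlt y hy i hi)).symm
  -- derivatives of `F = K + G`
  have hF : ∀ y ∈ Ioo a b, HasDerivAt (fun t : ℝ => ∑ i ∈ s, w i * ρ i / (t - ρ i) ^ 2 + G t)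
      (∑ i ∈ s, -2 * (w i * ρ i) / (y - ρ i) ^ 3 + G' y) y :=
    fun y hy => (hasDerivAt_rootKernel_two s w ρ (hne y hy)).add (hG y hy)
  -- `e^{σy}K′` strictly increasing
  have hK : StrictMonoOn (fun y => Real.exp (σ * y) * ∑ i ∈ s, -2 * (w i * ρ i) / (y - ρ i) ^ 3) (Ioo a b) := by
    refine strictMonoOn_of_deriv_pos (convex_Ioo a b) ?_ ?_
    · intro y hy
      have h1 : HasDerivAt (fun y => Real.exp (σ * y)) (Real.exp (σ * y) * (σ * 1)) y :=
        ((hasDerivAt_id' y).const_mul σ).exp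
      exact (h1.fun_mul (hasDerivAt_rootKernel_three s w ρ (hne y hy))).continuousAt.continuousWithinAt
    · intro y hy
      rw [interior_Ioo] at hy
      have h1 : HasDerivAt (fun y => Real.exp (σ * y)) (Real.exp (σ * y) * (σ * 1)) y :=
        ((hasDerivAt_id' y).const_mul σ).exp
      rw [(h1.fun_mul (hasDerivAt_rootKernel_three s w ρ (hne y hy))).deriv]
      have hpos' := leftKernel_convexity_pos s w ρ hw hσ hne0 (ha.trans hy.1) (hlt y hy)
      have hexp : 0 < Real.exp (σ * y) := Real.exp_pos _
      have : Real.exp (σ * y) * (σ * 1) * ∑ i ∈ s, -2 * (w i * ρ i) / (y - ρ i) ^ 3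
          + Real.exp (σ * y) * ∑ i ∈ s, 6 * (w i * ρ i) / (y - ρ i) ^ 4
          = Real.exp (σ * y) * (∑ i ∈ s, 6 * (w i * ρ i) / (y - ρ i) ^ 4
              + σ * ∑ i ∈ s, -2 * (w i * ρ i) / (y - ρ i) ^ 3) := by ring
      rw [this]
      exact mul_pos hexp hpos'
  -- `e^{σy}G′` non-decreasing
  have hEG : MonotoneOn (fun y => Real.exp (σ * y) * G' y) (Ioo a b) := by
    have hE : MonotoneOn (fun y => Real.exp (σ * y)) (Ioo a b) := fun y _ z _ hyz =>
      Real.exp_le_exp.2 (mul_le_mul_of_nonneg_left hyz hσ0)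
    have h := hE.mul hG'mono (fun y _ => (Real.exp_pos _).le) hG'0
    exact h
  -- the sum is strictly increasing
  have hmono : StrictMonoOn (fun y => Real.exp (σ * y) * (∑ i ∈ s, -2 * (w i * ρ i) / (y - ρ i) ^ 3 + G' y)) (Ioo a b) := by
    have h := hK.add_monotone hEG
    refine (h.congr ?_)
    intro y _
    ring
  exact no_three_zeros_of_strictMonoOn_exp_mul_deriv hF hmono h₁ h₃ h12 h23 hz₁ hz₂ hz₃

/-- ★ **KERNEL-PLUS-CONVEX INNER SHELL — the owner's typed form** (scratch19 `KernelPlusConvexInnerShell`, verbatim): `G` twice differentiable on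
`(a,b)` with `G′ ≥ 0`, `G″ ≥ 0`; weights `w_i > 0`, roots `ρ_i ≤ a` (`0 < a < b`), one positive; then `Σ_i w_iρ_i/(x−ρ_i)² + G(x)` has no three
zeros `x₁ < x₂ < x₃` in `(a,b)`. [this file's theorem] -/
theorem kernelPlusConvexInnerShell :
    ∀ (ι : Type) (s : Finset ι) (w ρ : ι → ℝ) (G G' G'' : ℝ → ℝ) (a b : ℝ),
    (∀ i ∈ s, 0 < w i) → 0 < a → a < b → (∀ i ∈ s, ρ i ≤ a) → (∃ i ∈ s, 0 < ρ i) →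
    (∀ x ∈ Ioo a b, HasDerivAt G (G' x) x) → (∀ x ∈ Ioo a b, HasDerivAt G' (G'' x) x) →
    (∀ x ∈ Ioo a b, 0 ≤ G' x) → (∀ x ∈ Ioo a b, 0 ≤ G'' x) →
    ∀ x₁ x₂ x₃, x₁ ∈ Ioo a b → x₃ ∈ Ioo a b → x₁ < x₂ → x₂ < x₃ →
      (∑ i ∈ s, w i * ρ i / (x₁ - ρ i) ^ 2 + G x₁ = 0) →
      (∑ i ∈ s, w i * ρ i / (x₂ - ρ i) ^ 2 + G x₂ = 0) →
      (∑ i ∈ s, w i * ρ i / (x₃ - ρ i) ^ 2 + G x₃ = 0) → False := by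
  intro ι s w ρ G G' G'' a b hw ha _ hρ hpos hG hG' hG'0 hG''0 x₁ x₂ x₃ h₁ h₃ h12 h23 hz₁ hz₂ hz₃
  -- `G″ ≥ 0` on the open window makes `G′` non-decreasing there
  have hmono : MonotoneOn G' (Ioo a b) := by
    refine monotoneOn_of_deriv_nonneg (convex_Ioo a b) ?_ ?_ ?_
    · exact fun y hy => (hG' y hy).continuousAt.continuousWithinAt
    · rw [interior_Ioo]
      exact fun y hy => (hG' y hy).differentiableAt.differentiableWithinAt
    · rw [interior_Ioo]
      intro y hy
      rw [(hG' y hy).deriv]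
      exact hG''0 y hy
  exact kernelPlusConvex_inner_no_three_zeros s w ρ hw ha hρ hpos hG hG'0 hmono h₁ h₃ h12 h23 hz₁ hz₂ hz₃

end ProductPlusOne

end Summit.ValiantsHypothesis.ValiantsHypothesis.Theorems.LacunarySymmetroidMatrixDescartes
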